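import Summits.QuantumFields.YangMills.Theorems.UnitScaleTiltProp7CombTowerWindowsOfRegPrT3
import Summits.QuantumFields.YangMills.Theorems.UnitScaleTiltProp7CombTowerPertWindowsOfIn19T3
import Summits.QuantumFields.YangMills.Theorems.UnitScaleTiltProp7CombCellLevelZeroCurrencyT3
import Summits.QuantumFields.YangMills.Theorems.UnitScaleTiltProp7CombPeriodCellDict
import Literature.MathematicalPhysics.QuantumFieldTheory.Balaban1983to89.B7Eq106Concrete
import Literature.MathematicalPhysics.QuantumFieldTheory.Balaban1983to89.B4Eq19LatticeOperators
import HarnessLib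

/-!
# `UnitScaleTiltProp7CombTildRem2HMcomb2MemberRowsT3` — M-4b-0 OF px18 g4's H2-1(E) MEMBER-KNIT (seam (β) with w3-20520 g12 11:08Z∕11:26Z): **THE MEMBER-SIDE ROWS THAT
# w3's `Prop7CornerCombH21EOfRows.h21E_of_rows` CONSUMES, READ OFF `RegPr` + `In19` AT EVERY RE-BASED LEVEL** — window products, periods, the cell inside the box, and the
# level-0 currencies `M`, `G₀` in `hMc₂`'s own letters
(route `UnitScaleTilt`, crux K1 «MinimiserStabilityRegPr» stmt-QuantumFields-19200; (β) row `hMcomb₂`; def-free, count-neutral, `--supports stmt-QuantumFields-19200 --as helper`).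
Cell `ym3-torus` (HUMAN RULING D-0037, YM ladder rung R3 — YM₃ on T³ is a rung, not d = 4, not infinite volume, not a mass gap, not Clay), width seat `ym3-torus-px17` (gen 5).

WHY.  w3-20520 g12's `h21E_of_rows` (M-3 proper, on `ℤ³`, abstract `Q`∕`P`∕windows) prices the level-`l` cell `ℓ¹` norm of the second-order defect `E_l` by `Am₂(Lˡ)⁻¹ + Bm₂Lˡ` from
DISPLAYED rows: per re-based level the unitarity∕loop windows `hV`, `hα`, `hα24` and the weight products `hprod : Π_{m<i}(L·L⁻ᵈ + 2d·210·α_m·(2d+2)L) ≤ E·(L²)^{−i}`, the periods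
`N_j = N_l·L^{l−j}`, the box `2R+1 ≤ 2N_l`, and at level 0 the currencies `Σ‖X♯‖² ≤ M`, `GAPcell₀(X♯) ≤ G₀`, `‖E_0‖ ≤ c₀‖X♯‖²`.  This file discharges every one of them at the T³
member from `RegPr F n K ε₀ W` (★routeR-w1 ✓`Prop7CombTowerWindowsOfRegPr`, F-8c-3a) and `In19` (my ✓`Prop7CombTowerPertWindowsOfIn19`, F-8c-3b; ✓`Prop7CombCellLevelZeroCurrencyT3`,
F-8c-2), so that M-4b proper is ONE `exact h21E_of_rows …` followed by M-4a ✓`hMcomb₂_of_cellRow`.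

WHAT IS PROVED (ns `…Theorems.Prop7CombTildRem2HMcomb2MemberRowsT3`; sorry-free):
* §1 (reals) `sum_geom_shift_le` (`Σ_{m<i} q^{k₀−j−m} ≤ 1∕(1−q)` for `j + i ≤ k₀ + 1`, `0 ≤ q < 1`), `prod_le_exp_sum` (`Π(c·(1+x_m)) ≤ cⁱ·exp(Σx_m)`);
* §2 (the member's window letters, absolute level `k ≤ K − n`; `α_k := 2·(8(d+1)(d+4)L²·a_k)`, `a_k := 2·(2ε₀(Lᵏ(L^{K−n})⁻¹)²)` = F-8c-3a's letter) `alphaLev_nonneg`, `sum_alphaLev_le`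
  (`Σ_{m<i} α_{j+m} ≤ 2016·L²·ε₀` for `j + i ≤ K − n + 1`), ★`prod_weights_le` (`Π_{m<i}(L·(Lᵈ)⁻¹ + 2d·(210·α_{j+m}·((2d+2)L))) ≤ exp(20321280·L⁵·ε₀)·((L²)ⁱ)⁻¹` — w3's `hprod₀`∕`hprodj`
  with `E := exp(20321280·L⁵·ε₀)`), `exp_window_le` (`10⁸L⁵ε₀ ≤ 1 ⇒ E ≤ 3∕2`), ★`hV_rebased`∕`hα_rebased`∕`hα24_rebased` (F-8c-3a at the re-based tower `avgIter L (avgIter L U₀♯ (j+1)) k =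
  avgIter L U₀♯ (j+1+k)`, lit ✓`B7Eq106Concrete.avgIter_add`);
* §3 (periods, boxes) `sitesPerDir_eq_mul_pow_sub` (`N_j = N_l·L^{l−j}`), `tildIter_add_period_T3` ∕ `pull_add_period_T3` (coordinate periodicity of `Ỹ_j` and of `X♯` in the `+ N•e_κ`
  letter), `boxVec_mem_box_zero`, ★`sum_cell_le_sum_box` (`Σ_{t : Fin d → Fin N} g(boxVec N t) ≤ Σ_{z ∈ box 0 (N−1)} g z` for `g ≥ 0` — the cell inside w3's `box c R`, `2R+1 = 2N−1 ≤ 2N`);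
* §4 (level 0) `norm_E0_le_sq` (`‖(e^{(iX)♯} − 1) − (iX)♯‖ ≤ ‖(iX)♯‖²` pointwise for `‖X b‖ ≤ 1`, lit ✓`norm_exp_sub_one_le_of_norm_le` + `expRem_le_sq`), `cellMass_iX_le` (`≤ Σ_b‖X b‖²`),
  ★★`cellGap_iX_le_of_regPr` (`GAPcell₀((iX)♯) ≤ 2·(2K_W(iX) + 96a²M) + DIV_W(iX) + 12a·M`, `a = ε₀((L^{K−n})²)⁻¹` — px13 ✓`sum_sq_norm_sub_norm_I_smul_le_plaqK` read on the cell through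
  ★routeR-w1 ✓F-8c-1 `sum_cell_transl_eq_sum_site`; `K_W`, `DIV_W` = `hMc₂`'s B-slot sums TOKEN FOR TOKEN).
HONEST FRAMING.  Bookkeeping over landed rows (S–M); nothing of M-3 proper∕M-4b proper∕H2-1(E)∕`hMcomb₂`∕`hMcomb`∕(β)∕EX∕the crux is proved; rung R3, not Clay; the YM mass gap is NOT proved.
References: T. Bałaban, CMP 98 (1985) 17–51 [Balaban1985Averaging] ((42)–(47) pp.23–25, (52)–(54) p.26, (69) p.29, Prop. 3 (122)–(126) p.36); CMP 99 (1985) 75–102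
[Balaban1985RegularSpaces] (p.77, (1.3)); CMP 102 (1985) 277–309 [Balaban1985Variational] ((2) p.278, (19) p.281, (47)–(48) pp.285–286, (135) p.298); CMP 109 (1987) 249–301
[Balaban1987RG1] ((0.1) p.251); M. Giaquinta [Giaquinta1984] (Ch. III §1 p.64).
-/

set_option autoImplicit false

noncomputable section

open scoped BigOperators Matrix.Norms.L2Operator

namespace Summit.QuantumFields.YangMills.Theorems.Prop7CombTildRem2HMcomb2MemberRowsT3

open Finset NormedSpace
open Literature.MathematicalPhysics.QuantumFieldTheory.Balaban1983to89
open Literature.MathematicalPhysics.QuantumFieldTheory.Balaban1983to89.T3ContinuumYM3Torus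
open T3PrintedRegularMinimiser (RegPr)
open T3SectALandauChart (eta eta_pos bgUnits In19)
open B7Prop1Explicit renaming Site → LSite
open B7Prop1Explicit (e boxVec Wcx expUnit val_expUnit expRem expRem_le_sq norm_exp_sub_one_le_of_norm_le)
open B7Prop2Explicit (avgIter unitaryUnits)
open B7Prop3Flat (expCfg)
open B7Eq92Concrete (tildIter tildIter_zero')
open B7Eq106Concrete (avgIter_add)
open B9Eq39Adjoint (divB)
open B9TorusCalculus (torusT)
open B10StarCount (sum_pbond)
open B10Eq27TorusAxialLog (transl transl_add_e pull pull_apply unitsField toUField)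
open T4TermwiseTorus (IsPeriodic)
open B4Eq19LatticeOperators (box mem_box)
open Summit.QuantumFields.YangMills.Theorems.Prop7SPrint (basePt)
open Summit.QuantumFields.YangMills.Theorems.Prop7SymAvgTwFrameDiff (pull_expUnit_eq_expCfg)
open Summit.QuantumFields.YangMills.Theorems.Prop7CombPeriodCellDict (isPeriodic_tildIter_T3 sitesPerDir_T3_mul_pow)
open Summit.QuantumFields.YangMills.Theorems.Prop7LandauCombDict (isPeriodic_pull)
open Summit.QuantumFields.YangMills.Theorems.Prop7CombPullbackGradDict (sum_cell_transl_eq_sum_site)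
open Summit.QuantumFields.YangMills.Theorems.Prop7CombTowerWindowsOfRegPr (norm_Wcx_avgIter_pull_sub_one_le_level_of_regPr alpha_level_le_window
  avgIter_pull_mem_unitaryUnits_of_regPr)
open Summit.QuantumFields.YangMills.Theorems.Prop7TwistedLevelMassOfRegPr (plaq_le_of_regPr)
open Summit.QuantumFields.YangMills.Theorems.Prop7PertVarNormGradLevelZeroT3 (sum_sq_norm_sub_norm_I_smul_le_plaqK)
open Summit.QuantumFields.YangMills.Theorems.Prop7CombCellLevelZeroCurrencyT3 (cellMass_I_smul_X_eq_T3)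

/-! ## §1 Two real letters -/

/-- `Σ_{m<i} q^{k₀−j−m} ≤ 1∕(1−q)` for `0 ≤ q < 1` and `j + i ≤ k₀ + 1` (reflect `m ↦ i−1−m`: the exponents are `≥ i−1−m`, then the geometric series). [folklore] -/
theorem sum_geom_shift_le {q : ℝ} (hq0 : 0 ≤ q) (hq1 : q < 1) {i j k₀ : ℕ} (h : j + i ≤ k₀ + 1) :
    ∑ m ∈ range i, q ^ (k₀ - j - m) ≤ 1 / (1 - q) := by
  have hterm : ∀ m ∈ range i, q ^ (k₀ - j - m) ≤ q ^ (i - 1 - m) := by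
    intro m hm
    have hmi := mem_range.mp hm
    exact pow_le_pow_of_le_one hq0 hq1.le (by omega)
  refine (sum_le_sum hterm).trans ?_
  rw [sum_range_reflect (fun m => q ^ m) i]
  have h1 : 0 < 1 - q := by linarith
  rw [le_div_iff₀ h1, geom_sum_mul_neg q i]
  have : 0 ≤ q ^ i := pow_nonneg hq0 i
  linarith

/-- `Π_{m<i} (c·(1 + x_m)) ≤ cⁱ·exp(Σ_{m<i} x_m)` for `c, x_m ≥ 0` (`1 + x ≤ eˣ`). [folklore] -/
theorem prod_le_exp_sum {c : ℝ} (hc : 0 ≤ c) (x : ℕ → ℝ) (hx : ∀ m, 0 ≤ x m) (i : ℕ) :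
    ∏ m ∈ range i, (c * (1 + x m)) ≤ c ^ i * Real.exp (∑ m ∈ range i, x m) := by
  have hre : c ^ i * Real.exp (∑ m ∈ range i, x m) = ∏ m ∈ range i, (c * Real.exp (x m)) := by
    rw [Real.exp_sum, prod_mul_distrib, prod_const, card_range]
  rw [hre]
  refine prod_le_prod (fun m _ => mul_nonneg hc (by linarith [hx m])) fun m _ => ?_
  exact mul_le_mul_of_nonneg_left (by linarith [Real.add_one_le_exp (x m)]) hc

/-! ## §2 The member's window letters at every (re-based) level -/

section Windows

variable (F : T3Family) {n K : ℕ}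

/-- `0 ≤ α_k` (F-8c-3a's loop-window letter). [cite: Balaban1985Averaging, (47) p.25] -/
theorem alphaLev_nonneg {ε₀ : ℝ} (hε₀ : 0 ≤ ε₀) (k : ℕ) :
    0 ≤ 2 * (8 * ((F.P K).d + 1) * ((F.P K).d + 4) * ((F.P K).L : ℝ) ^ 2 * (2 * (2 * ε₀ * ((((F.P K).L : ℝ)) ^ k * ((((F.P K).L : ℝ)) ^ (K - n))⁻¹) ^ 2))) := by
  positivity

/-- `α_k = 1792·L²·ε₀·(L⁻²)^{(K−n)−k}` for `k ≤ K − n` (`d = 3`). [cite: Balaban1985Averaging, (47) p.25; Balaban1985Variational, (2) p.278] -/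
theorem alphaLev_eq {ε₀ : ℝ} {k : ℕ} (hk : k ≤ K - n) :
    2 * (8 * ((F.P K).d + 1) * ((F.P K).d + 4) * ((F.P K).L : ℝ) ^ 2 * (2 * (2 * ε₀ * ((((F.P K).L : ℝ)) ^ k * ((((F.P K).L : ℝ)) ^ (K - n))⁻¹) ^ 2)))
      = 1792 * (F.L : ℝ) ^ 2 * ε₀ * ((((F.L : ℝ) ^ 2)⁻¹) ^ (K - n - k)) := by
  have hd : ((F.P K).d : ℝ) = 3 := by rw [T3Family.P_d]; norm_num
  have hLL : ((F.P K).L : ℝ) = F.L := rfl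
  have hL0 : (F.L : ℝ) ≠ 0 := by have := F.hL.2; positivity
  rw [hd, hLL]
  have hratio : (F.L : ℝ) ^ k * ((F.L : ℝ) ^ (K - n))⁻¹ = ((F.L : ℝ) ^ (K - n - k))⁻¹ := by
    have e1 : (F.L : ℝ) ^ (K - n) = (F.L : ℝ) ^ k * (F.L : ℝ) ^ (K - n - k) := by rw [← pow_add, Nat.add_sub_cancel' hk]
    rw [e1, mul_inv, ← mul_assoc, mul_inv_cancel₀ (pow_ne_zero _ hL0), one_mul]
  rw [hratio, inv_pow, ← pow_mul, mul_comm (K - n - k) 2, pow_mul, ← inv_pow]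
  ring

/-- **THE LOOP WINDOWS SUM GEOMETRICALLY FROM THE TOP**: `Σ_{m<i} α_{j+m} ≤ 2016·L²·ε₀` whenever `j + i ≤ K − n + 1` (`Σ (L⁻²)^{…} ≤ 1∕(1−L⁻²) ≤ 9∕8`, `L ≥ 3`).
[cite: Balaban1985Averaging, (47) p.25, (126) p.36] -/
theorem sum_alphaLev_le {ε₀ : ℝ} (hε₀ : 0 ≤ ε₀) {i j : ℕ} (h : j + i ≤ K - n + 1) :
    ∑ m ∈ range i, 2 * (8 * ((F.P K).d + 1) * ((F.P K).d + 4) * ((F.P K).L : ℝ) ^ 2 *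
        (2 * (2 * ε₀ * ((((F.P K).L : ℝ)) ^ (j + m) * ((((F.P K).L : ℝ)) ^ (K - n))⁻¹) ^ 2)))
      ≤ 2016 * (F.L : ℝ) ^ 2 * ε₀ := by
  have hL3 : (3 : ℝ) ≤ F.L := by
    have h3 : 3 ≤ F.L := by obtain ⟨a, ha⟩ := F.hL.1; have := F.hL.2; omega
    exact_mod_cast h3
  have hq0 : 0 ≤ ((F.L : ℝ) ^ 2)⁻¹ := by positivity
  have hq1 : ((F.L : ℝ) ^ 2)⁻¹ < 1 := inv_lt_one_of_one_lt₀ (by nlinarith)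
  have hq9 : 1 / (1 - ((F.L : ℝ) ^ 2)⁻¹) ≤ 9 / 8 := by
    have h9 : ((F.L : ℝ) ^ 2)⁻¹ ≤ 1 / 9 := by
      rw [inv_eq_one_div]; exact one_div_le_one_div_of_le (by norm_num) (by nlinarith)
    rw [div_le_div_iff₀ (by linarith) (by norm_num)]; linarith
  have hterm : ∀ m ∈ range i, 2 * (8 * ((F.P K).d + 1) * ((F.P K).d + 4) * ((F.P K).L : ℝ) ^ 2 *
        (2 * (2 * ε₀ * ((((F.P K).L : ℝ)) ^ (j + m) * ((((F.P K).L : ℝ)) ^ (K - n))⁻¹) ^ 2)))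
      = 1792 * (F.L : ℝ) ^ 2 * ε₀ * ((((F.L : ℝ) ^ 2)⁻¹) ^ (K - n - j - m)) := by
    intro m hm
    have hmi := mem_range.mp hm
    rw [alphaLev_eq F (show j + m ≤ K - n by omega), Nat.sub_sub (K - n) j m]
  rw [sum_congr rfl hterm, ← mul_sum]
  have hgeom := sum_geom_shift_le hq0 hq1 h
  have h0 : 0 ≤ 1792 * (F.L : ℝ) ^ 2 * ε₀ := by positivity
  calc 1792 * (F.L : ℝ) ^ 2 * ε₀ * ∑ m ∈ range i, (((F.L : ℝ) ^ 2)⁻¹) ^ (K - n - j - m)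
      ≤ 1792 * (F.L : ℝ) ^ 2 * ε₀ * (9 / 8) := mul_le_mul_of_nonneg_left (hgeom.trans hq9) h0
    _ = 2016 * (F.L : ℝ) ^ 2 * ε₀ := by ring

/-- ★ **THE WEIGHT PRODUCTS OF THE RE-BASED TOWERS** (w3's `hprod₀`∕`hprodj`): with `α m := α_{j+m}` (absolute level `j + m ≤ K − n`),
`Π_{m<i}(L·(Lᵈ)⁻¹ + 2d·(210·α m·((2d+2)L))) ≤ exp(20321280·L⁵·ε₀)·((L²)ⁱ)⁻¹` (`d = 3`: each factor is `L⁻²(1 + 10080L³α_m) ≤ L⁻²·e^{10080L³α_m}`, and `Σα ≤ 2016L²ε₀`).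
[cite: Balaban1985Averaging, (47) p.25, Prop. 3 (122)–(126) p.36] -/
theorem prod_weights_le {ε₀ : ℝ} (hε₀ : 0 ≤ ε₀) {i j : ℕ} (h : j + i ≤ K - n + 1) :
    ∏ m ∈ range i, (((F.P K).L : ℝ) * (((F.P K).L : ℝ) ^ (F.P K).d)⁻¹
        + 2 * (F.P K).d * (210 * (2 * (8 * ((F.P K).d + 1) * ((F.P K).d + 4) * ((F.P K).L : ℝ) ^ 2 *
          (2 * (2 * ε₀ * ((((F.P K).L : ℝ)) ^ (j + m) * ((((F.P K).L : ℝ)) ^ (K - n))⁻¹) ^ 2)))) * ((2 * (F.P K).d + 2) * ((F.P K).L : ℝ))))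
      ≤ Real.exp (20321280 * (F.L : ℝ) ^ 5 * ε₀) * ((((F.L : ℝ) ^ 2) ^ i)⁻¹) := by
  have hd : ((F.P K).d : ℝ) = 3 := by rw [T3Family.P_d]; norm_num
  have hdN : (F.P K).d = 3 := T3Family.P_d F K
  have hLL : ((F.P K).L : ℝ) = F.L := rfl
  have hL0 : (0 : ℝ) < F.L := by have := F.hL.2; positivity
  -- the letters `α m`
  set α : ℕ → ℝ := fun m => 2 * (8 * ((F.P K).d + 1) * ((F.P K).d + 4) * ((F.P K).L : ℝ) ^ 2 *
      (2 * (2 * ε₀ * ((((F.P K).L : ℝ)) ^ (j + m) * ((((F.P K).L : ℝ)) ^ (K - n))⁻¹) ^ 2))) with hα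
  have hα0 : ∀ m, 0 ≤ α m := fun m => alphaLev_nonneg F hε₀ (j + m)
  -- each factor is `L⁻²·(1 + 10080·L³·α m)`
  have hfac : ∀ m, ((F.P K).L : ℝ) * (((F.P K).L : ℝ) ^ (F.P K).d)⁻¹ + 2 * (F.P K).d * (210 * α m * ((2 * (F.P K).d + 2) * ((F.P K).L : ℝ)))
      = ((F.L : ℝ) ^ 2)⁻¹ * (1 + 10080 * (F.L : ℝ) ^ 3 * α m) := by
    intro m
    rw [hdN]; push_cast; rw [hLL]
    field_simp
    ring
  rw [prod_congr rfl fun m _ => hfac m]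
  have hx : ∀ m, 0 ≤ 10080 * (F.L : ℝ) ^ 3 * α m := fun m => by have := hα0 m; positivity
  have hs := sum_alphaLev_le F hε₀ h
  have hexp : ∑ m ∈ range i, 10080 * (F.L : ℝ) ^ 3 * α m ≤ 20321280 * (F.L : ℝ) ^ 5 * ε₀ := by
    rw [← mul_sum]
    calc 10080 * (F.L : ℝ) ^ 3 * ∑ m ∈ range i, α m ≤ 10080 * (F.L : ℝ) ^ 3 * (2016 * (F.L : ℝ) ^ 2 * ε₀) :=
          mul_le_mul_of_nonneg_left hs (by positivity)
      _ = 20321280 * (F.L : ℝ) ^ 5 * ε₀ := by ring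
  calc ∏ m ∈ range i, ((F.L : ℝ) ^ 2)⁻¹ * (1 + 10080 * (F.L : ℝ) ^ 3 * α m)
      ≤ (((F.L : ℝ) ^ 2)⁻¹) ^ i * Real.exp (∑ m ∈ range i, 10080 * (F.L : ℝ) ^ 3 * α m) :=
        prod_le_exp_sum (by positivity) (fun m => 10080 * (F.L : ℝ) ^ 3 * α m) hx i
    _ ≤ (((F.L : ℝ) ^ 2)⁻¹) ^ i * Real.exp (20321280 * (F.L : ℝ) ^ 5 * ε₀) :=
        mul_le_mul_of_nonneg_left (Real.exp_le_exp.2 hexp) (by positivity)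
    _ = Real.exp (20321280 * (F.L : ℝ) ^ 5 * ε₀) * ((((F.L : ℝ) ^ 2) ^ i)⁻¹) := by rw [inv_pow, mul_comm]

/-- `exp(20321280·L⁵·ε₀) ≤ 3∕2` under the single displayed smallness `10⁸·L⁵·ε₀ ≤ 1` (`eˣ ≤ 1 + 2x` on `[0,1]`). [cite: Balaban1985Averaging, (126) p.36] -/
theorem exp_window_le {ε₀ : ℝ} (hε₀ : 0 ≤ ε₀) (hε : 10 ^ 8 * (F.L : ℝ) ^ 5 * ε₀ ≤ 1) : Real.exp (20321280 * (F.L : ℝ) ^ 5 * ε₀) ≤ 3 / 2 := by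
  have hx0 : 0 ≤ 20321280 * (F.L : ℝ) ^ 5 * ε₀ := by positivity
  have hL5 : (0 : ℝ) ≤ (F.L : ℝ) ^ 5 := by positivity
  have hx1 : 20321280 * (F.L : ℝ) ^ 5 * ε₀ ≤ 21 / 100 := by nlinarith [mul_nonneg hL5 hε₀]
  have habs : |20321280 * (F.L : ℝ) ^ 5 * ε₀| ≤ 1 := by rw [abs_of_nonneg hx0]; linarith
  have hb := Real.abs_exp_sub_one_le habs
  rw [abs_of_nonneg hx0] at hb
  have hb' := (abs_le.1 hb).2
  linarith

/-- `10⁸L⁵ε₀ ≤ 1 ⇒ 10⁷L⁴ε₀ ≤ 1` and `10⁷L³ε₀ ≤ 1` (`L ≥ 1`). [cite: Balaban1985Averaging, (52) p.26] -/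
theorem windows_of_ten8 {ε₀ : ℝ} (hε₀ : 0 ≤ ε₀) (hε : 10 ^ 8 * (F.L : ℝ) ^ 5 * ε₀ ≤ 1) :
    10 ^ 7 * (F.L : ℝ) ^ 4 * ε₀ ≤ 1 ∧ 10 ^ 7 * (F.L : ℝ) ^ 3 * ε₀ ≤ 1 := by
  have hL1 : (1 : ℝ) ≤ F.L := by exact_mod_cast F.hL.2.le
  have h54 : (F.L : ℝ) ^ 4 ≤ (F.L : ℝ) ^ 5 := pow_le_pow_right₀ hL1 (by norm_num)
  have h35 : (F.L : ℝ) ^ 3 ≤ (F.L : ℝ) ^ 5 := pow_le_pow_right₀ hL1 (by norm_num)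
  have hL5 : (0 : ℝ) ≤ (F.L : ℝ) ^ 5 := by positivity
  constructor <;> nlinarith [mul_le_mul_of_nonneg_right h54 hε₀, mul_le_mul_of_nonneg_right h35 hε₀, mul_nonneg hL5 hε₀]

/-- ★ **UNITARITY OF THE RE-BASED TOWER** (w3's `hVj`∕`hV₀`): `avgIter L (avgIter L U₀♯ a) k (x,μ) ∈ U(2)` for `a + k ≤ K − n` (lit ✓`avgIter_add` ∘ F-8c-3a).
[cite: Balaban1985Averaging, (43) p.24, (52)–(54) p.26] -/
theorem hV_rebased {ε₀ : ℝ} (hε₀ : 0 < ε₀) (hε : 10 ^ 7 * (F.L : ℝ) ^ 3 * ε₀ ≤ 1)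
    (W : GaugeField (F.P K) 0 (Matrix.specialUnitaryGroup (Fin 2) ℂ)) (hreg : RegPr F n K ε₀ W) {a k : ℕ} (hk : a + k ≤ K - n)
    (x : LSite (F.P K).d) (μ : Fin (F.P K).d) :
    avgIter (F.P K).L (avgIter (F.P K).L (pull (bgUnits F K W) (basePt F n K)) a) k x μ ∈ unitaryUnits (Matrix (Fin 2) (Fin 2) ℂ) := by
  rw [avgIter_add]
  exact avgIter_pull_mem_unitaryUnits_of_regPr F hε₀ hε W hreg hk x μ

/-- ★ **THE LOOP WINDOW OF THE RE-BASED TOWER** (w3's `hαj`∕`hα₀`): `‖W_{c,x_r}(avgIter L (avgIter L U₀♯ a) k) − 1‖ ≤ α_{a+k}` for `a + k ≤ K − n`, at every base `q`.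
[cite: Balaban1985Averaging, (42)–(47) pp.23–25] -/
theorem hα_rebased {ε₀ : ℝ} (hε₀ : 0 < ε₀) (hε : 10 ^ 7 * (F.L : ℝ) ^ 3 * ε₀ ≤ 1)
    (W : GaugeField (F.P K) 0 (Matrix.specialUnitaryGroup (Fin 2) ℂ)) (hreg : RegPr F n K ε₀ W) {a k : ℕ} (hk : a + k ≤ K - n)
    (q : LSite (F.P K).d) (κ : Fin (F.P K).d) (r : Fin (F.P K).d → Fin (F.P K).L) :
    ‖((Wcx (F.P K).L (avgIter (F.P K).L (avgIter (F.P K).L (pull (bgUnits F K W) (basePt F n K)) a) k) q κ (boxVec (F.P K).L r) :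
        (Matrix (Fin 2) (Fin 2) ℂ)ˣ) : Matrix (Fin 2) (Fin 2) ℂ) - 1‖
      ≤ 2 * (8 * ((F.P K).d + 1) * ((F.P K).d + 4) * ((F.P K).L : ℝ) ^ 2 * (2 * (2 * ε₀ * ((((F.P K).L : ℝ)) ^ (a + k) * ((((F.P K).L : ℝ)) ^ (K - n))⁻¹) ^ 2))) := by
  rw [avgIter_add]
  exact norm_Wcx_avgIter_pull_sub_one_le_level_of_regPr F hε₀ hε W hreg hk q κ r

/-- `α_k ≤ 1∕24` (`≤ 1∕64`, F-8c-3a). [cite: Balaban1985Averaging, (47) p.25] -/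
theorem hα24_level {ε₀ : ℝ} (hε₀ : 0 < ε₀) (hε : 10 ^ 7 * (F.L : ℝ) ^ 3 * ε₀ ≤ 1)
    (W : GaugeField (F.P K) 0 (Matrix.specialUnitaryGroup (Fin 2) ℂ)) (hreg : RegPr F n K ε₀ W) {k : ℕ} (hk : k ≤ K - n) :
    2 * (8 * ((F.P K).d + 1) * ((F.P K).d + 4) * ((F.P K).L : ℝ) ^ 2 * (2 * (2 * ε₀ * ((((F.P K).L : ℝ)) ^ k * ((((F.P K).L : ℝ)) ^ (K - n))⁻¹) ^ 2))) ≤ 1 / 24 :=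
  (alpha_level_le_window F hε₀ hε W hreg hk).trans (by norm_num)

end Windows

/-! ## §3 Periods, and the cell inside the box -/

section Periods

variable (F : T3Family) (K : ℕ)

/-- `N_j = N_l·L^{l−j}` for `j ≤ l ≤ m + K` (both equal `N₀` after multiplying by `Lʲ`, ✓F-8a `sitesPerDir_T3_mul_pow`). [cite: Balaban1985RegularSpaces, p.77; Balaban1987RG1, (0.1) p.251] -/
theorem sitesPerDir_eq_mul_pow_sub {j l : ℕ} (hjl : j ≤ l) (hl : l ≤ F.m + K) :
    (F.P K).sitesPerDir j = (F.P K).sitesPerDir l * F.L ^ (l - j) := by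
  have hj := sitesPerDir_T3_mul_pow F K (hjl.trans hl)
  have hl' := sitesPerDir_T3_mul_pow F K hl
  have hL : 0 < F.L ^ j := pow_pos (by have := F.hL.2; omega) j
  have e : (F.P K).sitesPerDir l * F.L ^ (l - j) * F.L ^ j = (F.P K).sitesPerDir j * F.L ^ j := by
    rw [mul_assoc, ← pow_add, Nat.sub_add_cancel hjl, hl', hj]
  exact (Nat.eq_of_mul_eq_mul_right hL e).symm

variable {K} (n : ℕ)

/-- **COORDINATE PERIODICITY OF `Ỹ_j`** (w3's `hperj` letter): for `j ≤ m + K`, the comb tower of the based pullbacks satisfies `Ũʲ(x + N_j•e_κ) = Ũʲ(x)` (✓F-8a `isPeriodic_tildIter_T3` ∘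
✓`isPeriodic_pull`). [cite: Balaban1985Averaging, (69) p.29; Balaban1987RG1, (0.1) p.251] -/
theorem tildIter_add_period_T3 (W : GaugeField (F.P K) 0 (Matrix.specialUnitaryGroup (Fin 2) ℂ)) (X : PBond (F.P K) 0 → Matrix (Fin 2) (Fin 2) ℂ)
    {j : ℕ} (hj : j ≤ F.m + K) (x : LSite (F.P K).d) (κ : Fin (F.P K).d) :
    (fun ν => ((tildIter (F.P K).L (pull (bgUnits F K W) (basePt F n K)) (expCfg fun x μ => Complex.I • X ⟨transl (basePt F n K) x, μ⟩) j
        (x + (((F.P K).sitesPerDir j : ℕ) : ℤ) • e κ) ν : (Matrix (Fin 2) (Fin 2) ℂ)ˣ) : Matrix (Fin 2) (Fin 2) ℂ) - 1)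
      = fun ν => ((tildIter (F.P K).L (pull (bgUnits F K W) (basePt F n K)) (expCfg fun x μ => Complex.I • X ⟨transl (basePt F n K) x, μ⟩) j x ν :
        (Matrix (Fin 2) (Fin 2) ℂ)ˣ) : Matrix (Fin 2) (Fin 2) ℂ) - 1 := by
  have hU₀ := isPeriodic_pull (bgUnits F K W) (basePt F n K)
  have hU₁ : IsPeriodic ((F.P K).sitesPerDir 0) (expCfg fun x μ => Complex.I • X ⟨transl (basePt F n K) x, μ⟩) := by
    rw [← pull_expUnit_eq_expCfg F (fun b => Complex.I • X b) (basePt F n K)]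
    exact isPeriodic_pull _ _
  have hp := isPeriodic_tildIter_T3 F K hU₀ hU₁ hj x (e κ)
  funext ν
  exact congrArg (fun u : (Matrix (Fin 2) (Fin 2) ℂ)ˣ => (u : Matrix (Fin 2) (Fin 2) ℂ) - 1) (congrFun hp ν)

/-- **COORDINATE PERIODICITY OF `X♯`** (w3's `hper0`): `(iX)♯(x + N₀•e_κ) = (iX)♯(x)`. [cite: Balaban1985RegularSpaces, (1.3) p.77] -/
theorem iX_add_period_T3 (X : PBond (F.P K) 0 → Matrix (Fin 2) (Fin 2) ℂ) (x : LSite (F.P K).d) (κ : Fin (F.P K).d) :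
    (fun μ => Complex.I • X ⟨transl (basePt F n K) (x + (((F.P K).sitesPerDir 0 : ℕ) : ℤ) • e κ), μ⟩)
      = fun μ => Complex.I • X ⟨transl (basePt F n K) x, μ⟩ := by
  have hp := isPeriodic_pull (fun b : PBond (F.P K) 0 => Complex.I • X b) (basePt F n K) x (e κ)
  funext μ
  have := congrFun hp μ
  simpa only [pull_apply] using this

end Periods

section Box

variable {d : ℕ}

/-- `boxVec N t ∈ box 0 (N − 1)` (coordinates in `[0, N−1]`). [cite: Giaquinta1984, Ch. III §1 p.64] -/
theorem boxVec_mem_box_zero (N : ℕ) (t : Fin d → Fin N) : boxVec N t ∈ box (0 : LSite d) ((N : ℤ) - 1) := by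
  rw [mem_box]
  intro i
  have h1 : (0 : ℤ) ≤ ((t i : ℕ) : ℤ) := by positivity
  have h2 : ((t i : ℕ) : ℤ) ≤ (N : ℤ) - 1 := by have := (t i).isLt; omega
  simp only [boxVec, Pi.zero_apply, sub_zero]
  rw [abs_of_nonneg h1]; exact h2

/-- ★ **THE CELL INSIDE THE BOX**: `Σ_{t : Fin d → Fin N} g(boxVec N t) ≤ Σ_{z ∈ box 0 (N−1)} g z` for `g ≥ 0` (`boxVec` is injective with image in the box; w3's `box c R` at
`c := 0`, `R := N − 1`, `2R + 1 = 2N − 1 ≤ 2N`). [cite: Giaquinta1984, Ch. III §1 p.64; Balaban1987RG1, (0.1) p.251] -/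
theorem sum_cell_le_sum_box (N : ℕ) (g : LSite d → ℝ) (hg : ∀ z, 0 ≤ g z) :
    ∑ t : Fin d → Fin N, g (boxVec N t) ≤ ∑ z ∈ box (0 : LSite d) ((N : ℤ) - 1), g z := by
  classical
  rw [← Finset.sum_image (f := g) (s := Finset.univ) (g := boxVec N) fun r _ r' _ h => T4TermwiseTorus.boxVec_injective N h]
  exact Finset.sum_le_sum_of_subset_of_nonneg (fun z hz => by
      obtain ⟨t, -, rfl⟩ := Finset.mem_image.mp hz
      exact boxVec_mem_box_zero N t) (fun z _ _ => hg z)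

end Box

/-! ## §4 The level-0 currencies at the member -/

section LevelZero

variable (F : T3Family) (n K : ℕ)

/-- **THE LEVEL-0 DEFECT IS SECOND ORDER** (w3's `hY0`, `c₀ := 1`): `‖(↑(expCfg (iX)♯ x μ) − 1) − (iX)♯ x μ‖ ≤ ‖(iX)♯ x μ‖²` whenever `‖X b‖ ≤ 1`
(`‖e^B − 1 − B‖ ≤ e^{‖B‖} − 1 − ‖B‖ ≤ ‖B‖²`). [cite: Balaban1985Averaging, (24) p.21, (65)–(69) p.29; Balaban1985Variational, (19) p.281] -/
theorem norm_E0_le_sq (X : PBond (F.P K) 0 → Matrix (Fin 2) (Fin 2) ℂ) (hX1 : ∀ b : PBond (F.P K) 0, ‖X b‖ ≤ 1) (x : LSite (F.P K).d) (μ : Fin (F.P K).d) :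
    ‖(((expCfg (fun x μ => Complex.I • X ⟨transl (basePt F n K) x, μ⟩) x μ : (Matrix (Fin 2) (Fin 2) ℂ)ˣ) : Matrix (Fin 2) (Fin 2) ℂ) - 1)
        - Complex.I • X ⟨transl (basePt F n K) x, μ⟩‖ ≤ 1 * ‖Complex.I • X ⟨transl (basePt F n K) x, μ⟩‖ ^ 2 := by
  have hB : ‖Complex.I • X ⟨transl (basePt F n K) x, μ⟩‖ ≤ 1 := by rw [norm_smul, Complex.norm_I, one_mul]; exact hX1 _
  have h := (norm_exp_sub_one_le_of_norm_le (le_refl ‖Complex.I • X ⟨transl (basePt F n K) x, μ⟩‖)).2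
  rw [one_mul]
  refine le_trans ?_ (h.trans (expRem_le_sq (norm_nonneg _) hB))
  rfl

/-- **THE LEVEL-0 MASS CURRENCY** (w3's `hMX`): `Σ_{t}Σ_ν ‖(iX)♯(boxVec N₀ t, ν)‖² ≤ Σ_b‖X b‖²` (equality, ✓F-8c-2 `cellMass_I_smul_X_eq_T3`). [cite: Balaban1985Variational, (19) p.281] -/
theorem cellMass_iX_le (X : PBond (F.P K) 0 → Matrix (Fin 2) (Fin 2) ℂ) :
    ∑ t : Fin (F.P K).d → Fin ((F.P K).sitesPerDir 0), ∑ ν : Fin (F.P K).d, ‖Complex.I • X ⟨transl (basePt F n K) (boxVec ((F.P K).sitesPerDir 0) t), ν⟩‖ ^ 2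
      ≤ ∑ b : PBond (F.P K) 0, ‖X b‖ ^ 2 :=
  le_of_eq (cellMass_I_smul_X_eq_T3 F K rfl (basePt F n K) X)

/-- ★★ **THE LEVEL-0 NORM-GAP CURRENCY IN `hMc₂`'s LETTERS** (w3's `hGX` WITHOUT any volume factor): at `W ∈ 𝔘_k(ε₀)`,
`GAPcell₀((iX)♯) = Σ_tΣ_νΣ_μ(‖(iX)♯(t+e_μ,ν)‖ − ‖(iX)♯(t,ν)‖)² ≤ 2·(2·K_W(iX) + 96·a²·Σ‖X‖²) + DIV_W(iX) + 12·a·Σ‖X‖²`, `a = ε₀·((L^{K−n})²)⁻¹` — the cell sum IS the torus sum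
(★routeR-w1 ✓F-8c-1 `sum_cell_transl_eq_sum_site`, lit ✓`sum_pbond`, ✓`transl_add_e`) and the torus row is px13 ✓`sum_sq_norm_sub_norm_I_smul_le_plaqK` at `N = 2`, `d = 3`, ✓`plaq_le_of_regPr`.
[cite: Balaban1985Variational, (2) p.278, (47)–(48) pp.285–286, (135) p.298; Balaban1985BackgroundPropagators, (3.4)–(3.8) pp.391–392] -/
theorem cellGap_iX_le_of_regPr {ε₀ : ℝ} (hε₀ : 0 ≤ ε₀) {W : GaugeField (F.P K) 0 (Matrix.specialUnitaryGroup (Fin 2) ℂ)} (hreg : RegPr F n K ε₀ W)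
    (X : PBond (F.P K) 0 → Matrix (Fin 2) (Fin 2) ℂ) :
    ∑ t : Fin (F.P K).d → Fin ((F.P K).sitesPerDir 0), ∑ ν : Fin (F.P K).d, ∑ μ : Fin (F.P K).d,
        (‖Complex.I • X ⟨transl (basePt F n K) (boxVec ((F.P K).sitesPerDir 0) t + e μ), ν⟩‖ - ‖Complex.I • X ⟨transl (basePt F n K) (boxVec ((F.P K).sitesPerDir 0) t), ν⟩‖) ^ 2
      ≤ 2 * (2 * (∑ p : Plaq (F.P K) 0, ‖((Complex.I • X ⟨p.src, p.μ⟩)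
          + ((W ⟨p.src, p.μ⟩ : Matrix (Fin 2) (Fin 2) ℂ) * (Complex.I • X ⟨p.src.shift p.μ, p.ν⟩) * star (W ⟨p.src, p.μ⟩ : Matrix (Fin 2) (Fin 2) ℂ))
          - (((W ⟨p.src, p.μ⟩ * W ⟨p.src.shift p.μ, p.ν⟩ * (W ⟨p.src.shift p.ν, p.μ⟩)⁻¹ : Matrix.specialUnitaryGroup (Fin 2) ℂ) : Matrix (Fin 2) (Fin 2) ℂ)
              * (Complex.I • X ⟨p.src.shift p.ν, p.μ⟩)
              * star ((W ⟨p.src, p.μ⟩ * W ⟨p.src.shift p.μ, p.ν⟩ * (W ⟨p.src.shift p.ν, p.μ⟩)⁻¹ : Matrix.specialUnitaryGroup (Fin 2) ℂ) : Matrix (Fin 2) (Fin 2) ℂ))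
          - (((GaugeField.plaqHol W p : Matrix.specialUnitaryGroup (Fin 2) ℂ) : Matrix (Fin 2) (Fin 2) ℂ) * (Complex.I • X ⟨p.src, p.ν⟩)
              * star ((GaugeField.plaqHol W p : Matrix.specialUnitaryGroup (Fin 2) ℂ) : Matrix (Fin 2) (Fin 2) ℂ)))‖ ^ 2)
          + 32 * 3 * (ε₀ * (((F.L : ℝ) ^ (K - n)) ^ 2)⁻¹) ^ 2 * ∑ b : PBond (F.P K) 0, ‖X b‖ ^ 2)
        + ∑ x : Site (F.P K) 0, ∑ j : Fin 2, ∑ k : Fin 2,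
            ‖(divB (torusT (F.P K) 0) (fun κ z => unitsField (toUField W) ⟨z, κ⟩) (fun κ z => Complex.I • X ⟨z, κ⟩) x) j k‖ ^ 2
        + 2 * 3 * (ε₀ * (((F.L : ℝ) ^ (K - n)) ^ 2)⁻¹) * (2 * ∑ b : PBond (F.P K) 0, ‖X b‖ ^ 2) := by
  -- the cell sum is the torus sum
  have hcell := sum_cell_transl_eq_sum_site F K (j := 0) (N := (F.P K).sitesPerDir 0) rfl (basePt F n K)
    (fun x => ∑ ν : Fin (F.P K).d, ∑ μ : Fin (F.P K).d, (‖Complex.I • X ⟨x.shift μ, ν⟩‖ - ‖Complex.I • X ⟨x, ν⟩‖) ^ 2)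
  have hlhs : ∑ t : Fin (F.P K).d → Fin ((F.P K).sitesPerDir 0), ∑ ν : Fin (F.P K).d, ∑ μ : Fin (F.P K).d,
        (‖Complex.I • X ⟨transl (basePt F n K) (boxVec ((F.P K).sitesPerDir 0) t + e μ), ν⟩‖ - ‖Complex.I • X ⟨transl (basePt F n K) (boxVec ((F.P K).sitesPerDir 0) t), ν⟩‖) ^ 2
      = ∑ b : PBond (F.P K) 0, ∑ μ : Fin (F.P K).d, (‖Complex.I • X ⟨b.src.shift μ, b.dir⟩‖ - ‖Complex.I • X b‖) ^ 2 := by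
    simp only [transl_add_e] at hcell ⊢
    rw [hcell, sum_pbond]
  rw [hlhs]
  have ha : 0 ≤ ε₀ * (((F.L : ℝ) ^ (K - n)) ^ 2)⁻¹ := by positivity
  have h := sum_sq_norm_sub_norm_I_smul_le_plaqK W ha (plaq_le_of_regPr F n K hreg) X
  have hd : ((F.P K).d : ℝ) = 3 := by rw [T3Family.P_d]; norm_num
  simp only [hd, Nat.cast_ofNat] at h
  convert h using 2

end LevelZero

end Summit.QuantumFields.YangMills.Theorems.Prop7CombTildRem2HMcomb2MemberRowsT3

end
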